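/-
Copyright (c) 2026 the pub-hodgecm-mathlib formalisation cell (harness21).  Prover seat hodgecm-mathlib-R90-C10-p07 (g0) acting for R90-TF section S8 «ContSpec-n½»
(dealer R90-CS-plan (g2), word 2026-09-04T22:53:21Z «next BY NAME»): the value of a `χ`-FLAT SECTION of `U(2,1)` on the big cell `ι(w₀)·u(X, θ s)` at COMPLEX exponent —
archimedean weight × `ARCH^{−z}` times finite weight × `h_f^{−z}` — the (a-2)-enabling section-factorisation letter.
-/
import Summits.HodgeConjecture.HodgeConjecture.Theorems.K2E1IntertwiningScalarEulerProductU3     -- ★ `rpow_borelHeight_weylLongU_heisChart_eq` ((a2)₃ at `k = 1`, real `σ`) + the big-cell currency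
import Summits.HodgeConjecture.HodgeConjecture.Theorems.K2E1BorelEisensteinUDefs                  -- ★ `flatSectionU φ z g = φ g · H(g)^z`
import Summits.HodgeConjecture.HodgeConjecture.Theorems.K2E1ChiIntertwiningScalarEulerProductU2  -- ★ J2′-1 (K2E1-p13): `ofReal_inv_cpow` (the `N = 2` cpow step)
import HarnessLib

/-!
# K2·E1 ∕ R90·S8 — `K2E1ChiSectionBigCellFactorisationU3`: A `χ`-FLAT SECTION OF `U(2,1)` ON THE BIG CELL AT COMPLEX `z` —
# `f_z^φ(ι(w₀)·u(X, θ s)) = (W_∞ · ARCH(X_∞, s_∞)^{−z}) · (W_f · h_f(X, s_f)^{−z})` whenever `φ(ι(w₀)·u(X, θ s)) = W_∞ · W_f`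

Cell `pub/hodgecm-mathlib`, crux h413 = `stmt-HodgeConjecture-24833`, route of record `HCCMUnconditional`; R90-TF section S8, the (V)∕(NV) road of socket #3
(census `R90/S8/CENSUS-sock3-piN.R90-C10-p07-g0.md` B1; R90-CS-p03's `CENSUS-ChiEulerProductU3` (a-2): «the section's value on the big cell = archimedean factor × ω_f · h_f^{−z}
— THIS is where the weight family ω is DEFINED from the section φ»).  THEOREMS ONLY (no `def`, no `instance`, no notation, no named-fact hypothesis, no `sorry`; default heartbeats);
lane `--supports stmt-HodgeConjecture-24833 --as helper` (count-neutral).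

THE MATHEMATICS ([MoeglinWaldspurger1995] II.1.6–II.1.7; [Rogawski1990] §7.3; [Langlands1976] Appendix).  The flat section attached to `φ : G(𝔸) → ℂ` is `f_z^φ(g) = φ(g)·H(g)^z`
(★ `flatSectionU`).  On the big cell of `U(2,1)_{L∕L⁺}`, ★ (a2)₃ (`K2E1HeightBigCellLineFormulaU3`, read at `k = 1` by ★ `rpow_borelHeight_weylLongU_heisChart_eq`) gives
`H(ι(w₀)·u(X, θ s)) = (ARCH(X_∞, ι s_∞) · h_f(X, s_f))⁻¹`, `ARCH = ∏_{w∣∞}((1 + ½‖X_w‖²)² + (wδ)² s_w²)`, `h_f = ∏ᶠ_w max(1, ‖X_w‖, ‖Z_w‖)`; both factors are `> 0`, so at COMPLEX `z`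
(§1) `H(·)^z = ARCH^{−z} · h_f^{−z}` (`Complex.mul_cpow_ofReal_nonneg`, ★ `ofReal_inv_cpow`).  If the section's WEIGHT on the big cell factors as `φ(ι(w₀)·u(X, θ s)) = W_∞·W_f`
(the (W) letter — for a pure-tensor `χ`-section: `W_∞ = ω_∞(X_∞, s_∞)`, `W_f = ∏ᶠ_v ω_v(X_v, s_v)`, the DEFINITION of the local weight family of R90-CS-p03's (a-1)∕(a-2)), then (§2, HEAD)
  **`f_z^φ(ι(w₀)·u(X, θ s)) = (W_∞ · ARCH^{−z}) · (W_f · h_f^{−z})`**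
— the product shape that the unfolding (★ (ν-1) `inv_measure_smul_integral_eq_heisChart_traceZeroLine_three`) and Fubini (`integral_prod_mul`) consume in (a-2), exactly as ★ J2′-1 §5
does at `N = 2`.  The letter is POINTWISE and shape-free (`W_∞, W_f : ℂ`), so the consumer instantiates it with its own weight functions.
HONEST LABEL: HC_CM is proved only modulo the 7 printed citations (2 remaining named inputs: hLiu418 = `stmt-HodgeConjecture-24832`, h413 = `stmt-HodgeConjecture-24833`) until rung 0
closes; this file asserts no named fact and closes no socket; the (W) letter `hW` is a hypothesis (its payer = the pure-tensor structure of the `χ`-section + the Iwasawa readings of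
★ `K2E1ChiLocalWeightShellU3`); count-neutral; unconditional.

* §1 **`cpow_borelHeight_weylLongU_heisChart_eq`** — `((H(ι(w₀)·u(X,θ s)) : ℝ) : ℂ)^z = ((ARCH : ℝ) : ℂ)^{−z} · (((h_f : ℝ≥0) : ℝ) : ℂ)^{−z}` for every `z : ℂ`.
* §2 **`flatSectionU_weylLongU_heisChart_eq_of_weight`** (HEAD).

## References
* [MoeglinWaldspurger1995] C. Mœglin, J.-L. Waldspurger, *Spectral Decomposition and Eisenstein Series* (1995), II.1.6–II.1.7.
* [Rogawski1990] J. D. Rogawski, *Automorphic Representations of Unitary Groups in Three Variables* (1990), §7.3.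
* [Langlands1976] R. P. Langlands, *On the Functional Equations Satisfied by Eisenstein Series*, LNM 544 (1976), Appendix.
-/

set_option autoImplicit false
set_option linter.dupNamespace false -- the mandated namespace repeats `HodgeConjecture.HodgeConjecture`

noncomputable section

open MeasureTheory NumberField NumberField.InfinitePlace IsDedekindDomain Filter
open scoped NNReal ENNReal
open Literature.NumberTheory.Automorphic Literature.NumberTheory.Automorphic.UnitaryGroup Literature.NumberTheory.GaloisRepresentations
open Summit.HodgeConjecture.HodgeConjecture.Cruxes.H413
open Summit.HodgeConjecture.HodgeConjecture.Cruxes.H413.K2E1BorelEisensteinU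
open Summit.HodgeConjecture.HodgeConjecture.Cruxes.H413.K2E1IntertwiningScalarEulerProductU3 (rpow_borelHeight_weylLongU_heisChart_eq)
open Summit.HodgeConjecture.HodgeConjecture.Cruxes.H413.K2E1HeightBigCellLineFormulaU3 (one_le_coe_finprod_heisZ_line_cm_three)
open Summit.HodgeConjecture.HodgeConjecture.Cruxes.H413.K2E1ChiIntertwiningScalarEulerProductU2 (ofReal_inv_cpow)

namespace Summit.HodgeConjecture.HodgeConjecture.Cruxes.H413.K2E1ChiSectionBigCellFactorisationU3

variable (L : Type) [Field L] [NumberField L] [IsCMField L] (hc : IsCMField.complexConj L * IsCMField.complexConj L = 1)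
  {δ : L} (hcδ : IsCMField.complexConj L δ = -δ) (hδ : δ ≠ 0)

/-! ## §1 The big-cell height at COMPLEX exponent -/

/-- **`H(ι(w₀)·u(X, θ s))^z = ARCH(X_∞, ι s_∞)^{−z} · h_f(X, s_f)^{−z}` in `ℂ` for every complex `z`** (★ (a2)₃ at `k = 1` read at `σ = 1` gives `H = ARCH⁻¹·h_f⁻¹` with both factors
`> 0`; then `Complex.mul_cpow_ofReal_nonneg` and ★ `ofReal_inv_cpow`). [cite: MoeglinWaldspurger1995, II.1.7] [cite: Rogawski1990, §7.3] -/
theorem cpow_borelHeight_weylLongU_heisChart_eq (z : ℂ) (X : AdeleRing (𝓞 L) L) (s : AdeleRing (𝓞 ↥(maximalRealSubfield L)) ↥(maximalRealSubfield L)) :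
    (((borelHeight (((quasiSplit (↥(maximalRealSubfield L)) L (IsCMField.complexConj L) 3).toAdelic (weylLongU ((IsCMField.complexConj L : L ≃ₐ[↥(maximalRealSubfield L)] L) : L →+* L) (rfl : ((StdForm.antidiagonal 3).over L) = ((StdForm.antidiagonal 3).over L)))) * (((heisChart hc (X, traceZeroLine ↥(maximalRealSubfield L) L (IsCMField.complexConj L) hcδ hδ s)) : ↥(adelicUnipotent ↥(maximalRealSubfield L) L (IsCMField.complexConj L) 3)) : (quasiSplit (↥(maximalRealSubfield L)) L (IsCMField.complexConj L) 3).Adelic))) : ℝ) : ℂ) ^ z =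
      (((∏ w : InfinitePlace L, ((1 + ‖(X.1) w‖ ^ 2 / 2) ^ 2 + (w δ) ^ 2 * (((InfiniteAdeleRing.ringEquiv_mixedSpace ↥(maximalRealSubfield L)) s.1).1 ⟨w.comap (algebraMap ↥(maximalRealSubfield L) L), K2E1HeightBigCellLineFormulaU2.isReal_comap_maximalRealSubfield L w⟩) ^ 2)) : ℝ) : ℂ) ^ (-z) *
        (((∏ᶠ w : HeightOneSpectrum (𝓞 L), max 1 (max ‖((X) : AdeleRing (𝓞 L) L).2 w‖₊
              ‖(heisZ (c := IsCMField.complexConj L) ((X) : AdeleRing (𝓞 L) L)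
                ((traceZeroLine ↥(maximalRealSubfield L) L (IsCMField.complexConj L) hcδ hδ
                  ((0, s.2) : AdeleRing (𝓞 ↥(maximalRealSubfield L)) ↥(maximalRealSubfield L)) :
                    traceZeroAdele ↥(maximalRealSubfield L) L (IsCMField.complexConj L)) : AdeleRing (𝓞 L) L)).2 w‖₊) : ℝ≥0) : ℝ) : ℂ) ^ (-z) := by
  have h1 := rpow_borelHeight_weylLongU_heisChart_eq L hc hcδ hδ 1 X s
  rw [Real.rpow_one, Real.rpow_neg_one, Real.rpow_neg_one, ← Complex.ofReal_mul] at h1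
  have h1' := Complex.ofReal_injective h1
  have hA : (0 : ℝ) < ∏ w : InfinitePlace L, ((1 + ‖(X.1) w‖ ^ 2 / 2) ^ 2 + (w δ) ^ 2 * (((InfiniteAdeleRing.ringEquiv_mixedSpace ↥(maximalRealSubfield L)) s.1).1 ⟨w.comap (algebraMap ↥(maximalRealSubfield L) L), K2E1HeightBigCellLineFormulaU2.isReal_comap_maximalRealSubfield L w⟩) ^ 2) :=
    Finset.prod_pos fun w _ => by positivity
  have hB : (0 : ℝ) < (((∏ᶠ w : HeightOneSpectrum (𝓞 L), max 1 (max ‖((X) : AdeleRing (𝓞 L) L).2 w‖₊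
              ‖(heisZ (c := IsCMField.complexConj L) ((X) : AdeleRing (𝓞 L) L)
                ((traceZeroLine ↥(maximalRealSubfield L) L (IsCMField.complexConj L) hcδ hδ
                  ((0, s.2) : AdeleRing (𝓞 ↥(maximalRealSubfield L)) ↥(maximalRealSubfield L)) :
                    traceZeroAdele ↥(maximalRealSubfield L) L (IsCMField.complexConj L)) : AdeleRing (𝓞 L) L)).2 w‖₊) : ℝ≥0)) : ℝ) :=
    lt_of_lt_of_le one_pos (one_le_coe_finprod_heisZ_line_cm_three L hcδ hδ X s.2)
  rw [h1', Complex.ofReal_mul, Complex.mul_cpow_ofReal_nonneg (inv_nonneg.2 hA.le) (inv_nonneg.2 hB.le), ofReal_inv_cpow hA, ofReal_inv_cpow hB]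

/-! ## §2 HEAD — the section's value on the big cell -/

/-- **HEAD — A `χ`-FLAT SECTION ON THE BIG CELL FACTORS AS (archimedean weight × `ARCH^{−z}`) × (finite weight × `h_f^{−z}`).**  For every `φ : G(𝔸) → ℂ`, every complex `z`, every
big-cell point `(X, s) ∈ 𝔸_L × 𝔸_{L⁺}`, and every factorisation of the WEIGHT `φ(ι(w₀)·u(X, θ s)) = W_∞ · W_f` (letter (W); for a pure-tensor `χ`-section `W_∞ = ω_∞(X_∞, s_∞)`,
`W_f = ∏ᶠ_v ω_v(X_v, s_v)` — the definition of R90-CS-p03's local weight family):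
`f_z^φ(ι(w₀)·u(X, θ s)) = (W_∞ · ARCH(X_∞, ι s_∞)^{−z}) · (W_f · h_f(X, s_f)^{−z})` (★ `flatSectionU_apply` + §1).
[cite: MoeglinWaldspurger1995, II.1.6] [cite: Rogawski1990, §7.3] [cite: Langlands1976, Appendix] -/
theorem flatSectionU_weylLongU_heisChart_eq_of_weight (φ : (quasiSplit (↥(maximalRealSubfield L)) L (IsCMField.complexConj L) 3).Adelic → ℂ) (z : ℂ)
    (X : AdeleRing (𝓞 L) L) (s : AdeleRing (𝓞 ↥(maximalRealSubfield L)) ↥(maximalRealSubfield L)) {Winf Wf : ℂ}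
    (hW : φ (((quasiSplit (↥(maximalRealSubfield L)) L (IsCMField.complexConj L) 3).toAdelic (weylLongU ((IsCMField.complexConj L : L ≃ₐ[↥(maximalRealSubfield L)] L) : L →+* L) (rfl : ((StdForm.antidiagonal 3).over L) = ((StdForm.antidiagonal 3).over L)))) * (((heisChart hc (X, traceZeroLine ↥(maximalRealSubfield L) L (IsCMField.complexConj L) hcδ hδ s)) : ↥(adelicUnipotent ↥(maximalRealSubfield L) L (IsCMField.complexConj L) 3)) : (quasiSplit (↥(maximalRealSubfield L)) L (IsCMField.complexConj L) 3).Adelic)) = Winf * Wf) :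
    flatSectionU φ z (((quasiSplit (↥(maximalRealSubfield L)) L (IsCMField.complexConj L) 3).toAdelic (weylLongU ((IsCMField.complexConj L : L ≃ₐ[↥(maximalRealSubfield L)] L) : L →+* L) (rfl : ((StdForm.antidiagonal 3).over L) = ((StdForm.antidiagonal 3).over L)))) * (((heisChart hc (X, traceZeroLine ↥(maximalRealSubfield L) L (IsCMField.complexConj L) hcδ hδ s)) : ↥(adelicUnipotent ↥(maximalRealSubfield L) L (IsCMField.complexConj L) 3)) : (quasiSplit (↥(maximalRealSubfield L)) L (IsCMField.complexConj L) 3).Adelic)) =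
      (Winf * (((∏ w : InfinitePlace L, ((1 + ‖(X.1) w‖ ^ 2 / 2) ^ 2 + (w δ) ^ 2 * (((InfiniteAdeleRing.ringEquiv_mixedSpace ↥(maximalRealSubfield L)) s.1).1 ⟨w.comap (algebraMap ↥(maximalRealSubfield L) L), K2E1HeightBigCellLineFormulaU2.isReal_comap_maximalRealSubfield L w⟩) ^ 2)) : ℝ) : ℂ) ^ (-z)) *
        (Wf * (((∏ᶠ w : HeightOneSpectrum (𝓞 L), max 1 (max ‖((X) : AdeleRing (𝓞 L) L).2 w‖₊
              ‖(heisZ (c := IsCMField.complexConj L) ((X) : AdeleRing (𝓞 L) L)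
                ((traceZeroLine ↥(maximalRealSubfield L) L (IsCMField.complexConj L) hcδ hδ
                  ((0, s.2) : AdeleRing (𝓞 ↥(maximalRealSubfield L)) ↥(maximalRealSubfield L)) :
                    traceZeroAdele ↥(maximalRealSubfield L) L (IsCMField.complexConj L)) : AdeleRing (𝓞 L) L)).2 w‖₊) : ℝ≥0) : ℝ) : ℂ) ^ (-z)) := by
  rw [flatSectionU_apply, hW, cpow_borelHeight_weylLongU_heisChart_eq L hc hcδ hδ z X s]
  ring

end Summit.HodgeConjecture.HodgeConjecture.Cruxes.H413.K2E1ChiSectionBigCellFactorisationU3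

end
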